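import Literature.MathematicalPhysics.QuantumFieldTheory.Balaban1983to89.B9SectBRatioComp
import Literature.MathematicalPhysics.QuantumFieldTheory.Balaban1983to89.B9Eq360VprimeLetters

/-!
# `Balaban1983to89.B9SectBRatioVprime` — [B9] Sect. B in other norms, item 2b INSTANTIATED ON r06's LETTER CARRIERS: the conjugated
# («ratio») majorant of V = G′(U)V′(A) for the FULL CONCRETE V′(A) of (3.60) (`B9Eq360VprimeLetters.vPrimeConc`, gradient ∕
# divergence form after coordinates), at the sharp-block sup sizes — `B9SectBRatioComp.hasMaj_ratio_sectB_sup` fed with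
# `hasMajorant_divForm_zeroth_vPrime` (zeroth order, C″) and `B9Eq352GradLetters.hasMajorant_coefLetter` (first-order coefficients)
# (cell `pub-ymgap`, Track A node N06 -b item 2b of `HANDOFF-dag-n06-b.md` §4, dag-lead REBALANCE-24; seat dag-n19-b; count-neutral
# MODEL bookkeeping)

References (bib keys): [B9] = `Balaban1985BackgroundPropagators`; [4] = `Balaban1984PropagatorsII`; [B8] = `Balaban1985RegularSpaces`
— only NAMED; loci certified in the headers of `B9Eq360VprimeLetters` ∕ `B9Eq352GradLetters` (r06) and `B9SectBRatioComp`.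

THE POINT.  After coordinates (`conj b`), r06's V′(A) is `(V⁰ − avgOp) + Σ_{k∈κ⊕κ} V¹_k∇_k` (`conj_vPrimeConc_eq_gradForm`), hence by
the letter Leibniz rule `Σ_k ∇_kV¹_k + C″` (`B9Ineq386CommSum.divForm_of_gradForm_sum`) with C″ ≺ c″·α₁·(Lʲη)⁻²·e^{−δd}
(`hasMajorant_divForm_zeroth_vPrime`) and V¹_k ≺ c′·α₁·(Lʲη)⁻¹·e^{−δd} (`hasMajorant_coefLetter`).  So G′V′ = G′C″ + Σ_k (G′∇_k)V¹_k
and **`hasMaj_ratio_vPrimeConc`** gives `G′(U)V′(A) ≺ θ·((Lʲη)²(y)∕(Lʲη)²(y′))·e^{−ρd}` between the sharp-block sup sizes with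
θ = B₀·c·C_ℓ²·α₁·(c″ + #(κ⊕κ)·c′) EXPLICIT — the `hV` of dag-n06-b's `neumann_left_weighted` (W = (Lʲη)²), hence Theorem 3.4's member
by `B9SectBRatioComp.thm34_member_of_ratio`.  INPUTS displayed: r06's letter hypotheses verbatim ((3.37) blockwise, the averaging
kernel bounds, the basis constant M₂, …), the members `G′ ≺ B₀(Lʲη)²e^{−ρ₁d}` and `G′∇_k ≺ B₀(Lʲη)e^{−ρ₁d}` of G′(U) ((3.42)₁,₃ by the
p. 398 remark — Theorems 3.1–3.3, hypotheses), the scale transfer of (2.2), Lemma 2.1's row sum.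

HONEST SCOPE.  Sharp-block sup sizes only (the block-L² ∕ Hölder-probe letters are not in the tree); nothing of print asserted; the
G′(U) members and the resolvent identity (3.62) stay hypotheses of the consumer.  Value = MODEL kernel bookkeeping, NOT summit progress;
NOT continuum, NOT Clay.
-/

namespace Literature.MathematicalPhysics.QuantumFieldTheory.Balaban1983to89.B9SectBRatioVprime

open Literature.MathematicalPhysics.QuantumFieldTheory.Balaban1983to89
open Literature.MathematicalPhysics.QuantumFieldTheory.Balaban1983to89.B6RandomWalk (HasMajorant hasMajorant_mono
  Triangle254 Ineq261)
open Literature.MathematicalPhysics.QuantumFieldTheory.Balaban1983to89.B9Thm34Ext (toB6)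
open Literature.MathematicalPhysics.QuantumFieldTheory.Balaban1983to89.B9Eq39Adjoint (covD covDstar)
open Literature.MathematicalPhysics.QuantumFieldTheory.Balaban1983to89.B9Eq352DivForm (tauB)
open Literature.MathematicalPhysics.QuantumFieldTheory.Balaban1983to89.B9Eq352DivFormLetters (conj conj_sub conj_mul)
open Literature.MathematicalPhysics.QuantumFieldTheory.Balaban1983to89.B9Eq352GradLetters (V1pOp V0op coefLetter
  diffLetter hasMajorant_coefLetter)
open Literature.MathematicalPhysics.QuantumFieldTheory.Balaban1983to89.B9Eq360VprimeLetters (vPrimeConc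
  conj_vPrimeConc_eq_gradForm hasMajorant_divForm_zeroth_vPrime)
open Literature.MathematicalPhysics.QuantumFieldTheory.Balaban1983to89.B9Ineq386CommSum (divForm_of_gradForm_sum)
open B11SectG B9SectBRatioComp

noncomputable section

variable {𝔸 : Type*} [NormedRing 𝔸] [NormedAlgebra ℂ 𝔸] [CompleteSpace 𝔸] {ι : Type} [Fintype ι]
variable (b : Module.Basis ι ℝ 𝔸) {S : Type} [Fintype S] {κ : Type} [Fintype κ]
variable (T : κ → Equiv.Perm S) (U : κ → S → 𝔸ˣ)
variable {g : B9.Geometry} [Fintype g.Site] [DecidableEq g.Site] {Rr : ℝ} {H : Prop}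

/-- **SECT. B ON r06's LETTER CARRIERS: THE RATIO MAJORANT OF G′(U)V′(A) FOR THE FULL CONCRETE V′(A) OF (3.60)** (sharp-block sup
sizes).  Hypotheses: r06's letter binders of `hasMajorant_divForm_zeroth_vPrime` verbatim; the members `G′ ≺ B₀(Lʲη)²e^{−ρ₁d}` and
`G′·conj b(∇_k) ≺ B₀(Lʲη)e^{−ρ₁d}` (k ∈ κ ⊕ κ: forward and minus-backward covariant differences `diffLetter`) of G′(U); the scale
transfer `ℓ(x) ≤ C_ℓe^{εd(x,y)}ℓ(y)`; Lemma 2.1's row sum at rate σ with constant c (symmetric distance); rates ρ + 2ε ≤ δ,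
ρ + ε + σ ≤ ρ₁.  Conclusion: `G′·conj b(V′(A)) ≺ B₀·c·C_ℓ²·(c″α₁ + #(κ⊕κ)·c′α₁)·((Lʲη)²(y)∕(Lʲη)²(y′))·e^{−ρd}` between the sup sizes,
c″, c′ r06's explicit letter constants. [cite: Balaban1985BackgroundPropagators, (3.60)–(3.64) p.402 + (3.52) p.400 + (3.37) p.396 + (3.42) p.397 + p.398 (remark); Balaban1984PropagatorsII, (2.51)–(2.55) p.232 + Lemma 2.1 p.234; Balaban1985RegularSpaces, (1.87) p.91] -/
theorem hasMaj_ratio_vPrimeConc (blk : S → g.Site) {η : ℝ} (hη : 0 < η) (A : κ → S → 𝔸)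
    (kQ kF : g.Site → S → 𝔸 →L[ℝ] 𝔸) (sQ sF : S → 𝔸 →L[ℝ] 𝔸) (c w : g.Site → ℝ) (ρu d₀ δ M₂ α₁ C a₀ : ℝ)
    (hα₁ : 0 ≤ α₁) (hδ : 0 ≤ δ) (hM₂ : 0 ≤ M₂) (hrepr : ∀ (v : 𝔸) (i : ι), |b.repr v i| ≤ M₂ * ‖v‖)
    (hlen : ∀ y : g.Site, 0 < g.len y) (hsmall : ∀ y : g.Site, η * (α₁ * (g.len y)⁻¹) ≤ 1 / 4)
    (hA : ∀ μ x, ‖A μ x‖ ≤ α₁ * (g.len (blk x))⁻¹ ∧ ‖tauB T U μ (A μ) x‖ ≤ α₁ * (g.len (blk x))⁻¹)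
    (h337s : ∀ μ x, ‖((η : ℂ)⁻¹) • covDstar T U μ (A μ) x‖ ≤ α₁ * (g.len (blk x) ^ 2)⁻¹)
    (h337F : ∀ μ x, ‖((η : ℂ)⁻¹) • covD T U μ (A μ) x‖ ≤ α₁ * (g.len (blk x) ^ 2)⁻¹)
    (h337B : ∀ μ x, ‖((η : ℂ)⁻¹) • covDstar T U μ (tauB T U μ (A μ)) x‖ ≤ α₁ * (g.len (blk x) ^ 2)⁻¹)
    (hρu : ∀ μ x, ‖((U μ x : 𝔸ˣ) : 𝔸)‖ ≤ ρu ∧ ‖(((U μ x)⁻¹ : 𝔸ˣ) : 𝔸)‖ ≤ ρu)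
    (hd₀ : ∀ μ x, g.dist (blk x) (blk (T μ x)) ≤ d₀ ∧ g.dist (blk x) (blk ((T μ).symm x)) ≤ d₀)
    (hd₀0 : ∀ y : g.Site, g.dist y y ≤ d₀)
    (hw : ∀ y, 0 ≤ w y) (hcard : ∀ y, ((B9Eq360Vprime.block blk y).card : ℝ) * w y ≤ 1) (hC : 0 ≤ C) (ha₀ : 0 ≤ a₀)
    (hkQ : ∀ y x, blk x = y → ‖kQ y x‖ ≤ w y) (hkF : ∀ y x, blk x = y → ‖kF y x‖ ≤ C * α₁ * w y)
    (hsQ : ∀ x, ‖sQ x‖ ≤ 1) (hsF : ∀ x, ‖sF x‖ ≤ C * α₁) (hc : ∀ y, |c y| ≤ a₀ * (g.len y ^ 2)⁻¹)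
    -- the G′(U) side and the rate bookkeeping
    {G' : Module.End ℝ (S × ι → ℝ)} {B₀ Cℓ ε ρ₁ ρ σ cc : ℝ}
    (htri : Triangle254 (toB6 g Rr H)) (hdnn : ∀ a b : g.Site, 0 ≤ g.dist a b)
    (hsymm : ∀ a b : g.Site, g.dist a b = g.dist b a) (hrow : RowSum (toB6 g Rr H) σ cc) (hcc : 0 ≤ cc)
    (hB₀ : 0 ≤ B₀) (hCℓ : 0 ≤ Cℓ) (hℓ : ∀ x y : g.Site, g.len x ≤ Cℓ * Real.exp (ε * g.dist x y) * g.len y)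
    (hρ0 : 0 ≤ ρ) (hε : 0 ≤ ε) (hρ₂ : ρ + 2 * ε ≤ δ) (hρ₁ : ρ + ε + σ ≤ ρ₁)
    (hG : HasMajorant (g := toB6 g Rr H) (fun p : S × ι => blk p.1) G'
      (fun a y => B₀ * g.len a ^ 2 * Real.exp (-(ρ₁ * g.dist a y))))
    (hGD : ∀ k : κ ⊕ κ, HasMajorant (g := toB6 g Rr H) (fun p : S × ι => blk p.1)
      (G' * conj b (diffLetter T U ((η : ℂ)⁻¹) k))
      (fun a y => B₀ * g.len a * Real.exp (-(ρ₁ * g.dist a y)))) :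
    HasMaj (BlockNorm.ofBlocks (toB6 g Rr H) (fun p : S × ι => blk p.1))
      (BlockNorm.ofBlocks (toB6 g Rr H) (fun p : S × ι => blk p.1))
      (G' * conj b (vPrimeConc T U η A blk kQ kF sQ sF c))
      (fun a b' => B₀ * cc * Cℓ ^ 2 *
        ((((((2 + 8 * ρu ^ 2 * α₁) * Fintype.card κ + a₀ * C * (2 + C * α₁)) + 4 * Fintype.card κ * ρu ^ 2)
            * M₂ * (∑ i, ‖b i‖) * Real.exp (δ * d₀)) * α₁) +
          (Finset.univ : Finset (κ ⊕ κ)).card * ((2 * M₂ * (∑ i, ‖b i‖) * Real.exp (δ * d₀)) * α₁)) *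
        (g.len a ^ 2 / g.len b' ^ 2) * Real.exp (-(ρ * g.dist a b'))) := by
  -- r06's letters
  have hC₀ := hasMajorant_divForm_zeroth_vPrime (Rr := Rr) (H := H) b T U blk hη A kQ kF sQ sF c w ρu d₀ δ M₂ α₁ C a₀
    hα₁ hδ hM₂ hrepr hlen hsmall hA h337s h337F h337B hρu hd₀ hd₀0 hw hcard hC ha₀ hkQ hkF hsQ hsF hc
  have hC₁ : ∀ k ∈ (Finset.univ : Finset (κ ⊕ κ)), HasMajorant (g := toB6 g Rr H) (fun p : S × ι => blk p.1)
      (conj b (coefLetter T U A k))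
      (fun y y' => (2 * M₂ * (∑ i, ‖b i‖) * Real.exp (δ * d₀)) * α₁ * (g.len y)⁻¹ * Real.exp (-(δ * g.dist y y'))) :=
    fun k _ => hasMajorant_coefLetter (Rr := Rr) (H := H) b T U blk A d₀ δ M₂ α₁ hα₁ hδ hM₂ hrepr hlen hA hd₀0 k
  -- the divergence form and the decomposition of G′V′
  have hgrad := conj_vPrimeConc_eq_gradForm b T U η A blk kQ kF sQ sF c
  have hdiv := divForm_of_gradForm_sum (Finset.univ : Finset (κ ⊕ κ)) hgrad
  have hV : G' * conj b (vPrimeConc T U η A blk kQ kF sQ sF c) =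
      G' ∘ₗ ((conj b (V0op T U η A) - conj b (B9Eq360VprimeLetters.avgOp blk kQ kF sQ sF c)) +
          ∑ k ∈ Finset.univ, (conj b (coefLetter T U A k) * conj b (diffLetter T U ((η : ℂ)⁻¹) k) -
            conj b (diffLetter T U ((η : ℂ)⁻¹) k) * conj b (coefLetter T U A k))) +
        ∑ k ∈ (Finset.univ : Finset (κ ⊕ κ)),
          (G' * conj b (diffLetter T U ((η : ℂ)⁻¹) k)) ∘ₗ conj b (coefLetter T U A k) := by
    rw [hdiv, mul_add, Finset.mul_sum, add_comm]
    rfl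
  have hsum0 : 0 ≤ ∑ i, ‖b i‖ := Finset.sum_nonneg fun i _ => norm_nonneg _
  have hc₀ : 0 ≤ ((((2 + 8 * ρu ^ 2 * α₁) * Fintype.card κ + a₀ * C * (2 + C * α₁)) + 4 * Fintype.card κ * ρu ^ 2)
      * M₂ * (∑ i, ‖b i‖) * Real.exp (δ * d₀)) * α₁ := by positivity
  have hc₁ : 0 ≤ (2 * M₂ * (∑ i, ‖b i‖) * Real.exp (δ * d₀)) * α₁ := by positivity
  exact hasMaj_ratio_sectB_sup (R := Rr) (H := H) (fun p : S × ι => blk p.1) (Finset.univ : Finset (κ ⊕ κ))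
    (fun k => G' * conj b (diffLetter T U ((η : ℂ)⁻¹) k)) (fun k => conj b (coefLetter T U A k))
    htri hdnn hsymm hrow hcc hB₀ hc₀ hc₁ hCℓ hlen hℓ hρ0 hε hρ₂ hρ₁ hG hC₀ (fun k _ => hGD k) hC₁ hV

end

end Literature.MathematicalPhysics.QuantumFieldTheory.Balaban1983to89.B9SectBRatioVprime
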